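import Mathlib
import Literature.Computability.Complexity.ExtMonotoneGates
import Literature.Computability.Complexity.CliqueApproximatorsWide
import Literature.Computability.Complexity.RossmanMonotoneCliqueProb
import Summits.PneNP.PneNP.Theses.ConvexRankGates
import Summits.PneNP.PneNP.Theorems.ConvexRankGatesLinAlgGateBlindDefs
import Summits.PneNP.PneNP.Theorems.ConvexRankGatesLinAlgGateBlindTermCollapse
import Summits.PneNP.PneNP.Theorems.ConvexRankGatesLinAlgGateBlindPluckingBound
import Summits.PneNP.PneNP.Theorems.ConvexRankGatesLinAlgGateBlindWideApproxHost
import Summits.PneNP.PneNP.Theorems.ConvexRankGatesLinAlgGateBlindDenseRegime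
import Summits.PneNP.PneNP.Theorems.ConvexRankGatesLinAlgGateBlindSGGRankCalibration
import Summits.PneNP.PneNP.Theorems.LinAlgGateBlind.Negative.CliquePolyDetRepr

/-!
# Route ConvexRankGates, crux `LinAlgGateBlind` (stmt-PneNP-10681): the crux reduces to two single-gate statements

Line `dnf-invariant-wide-gates-see-small-cliques` (lead prover, 2026-08-16). With the four scaffolding stubs of the line
LANDED (`stub_termCollapse`, `stub_pluckingBound`, `stub_wideApproxHost`, `stub_denseRegime`, imported above), the
kernel-checked composition of the line skeleton becomes an importable REDUCTION THEOREM: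

* `linAlgGateBlind_of_sgAt` — the crux `Summit.PneNP.PneNP.Theses.ConvexRankGates.LinAlgGateBlind` (no poly-size
  circuit over `{∧₂,∨₂} ∪ PERM_{m^c} ∪ GRANK_{m^c}` computes `CLIQUE(m,⌈m^δ⌉)`) FOLLOWS from the two single-gate,
  one-sided, distributional statements `SG_PERM` and `SG_GRANK` at `δ = 1/8`: every PERM (resp. GRANK) TERM GATE of
  parameter `m^c` over `≤ lOf m`-vertex clique atoms has a small-clique DNF losing `≤ epsOf c m · C(m, kOf m)` bare
  `kOf m`-cliques and gaining `≤ epsOf c m` of `G(m, qOf m)` (`SGAt`, `Theorems/ConvexRankGatesLinAlgGateBlindDefs.lean`).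
  Proof = Alon–Boppana approximation in the lattice `K(m, rOf c m, lOf m)` with the wide gates collapsed to term gates
  (`stub_termCollapse`), approximated by SG, re-closed (`stub_pluckingBound`), hosted by `stub_wideApproxHost` with the
  budgets of `stub_denseRegime`.
* `sgGRank_forces_dc_lowerBound` — CALIBRATION of the GRANK half: `SG_GRANK` alone forces, for every `c` and every field
  `F`, eventually in `m`, that the clique polynomial `CL_{m,⌈m^{1/8}⌉}` has NO affine determinantal representation of size
  `≤ m^c` (landed certificate `sgAt_gRank_dc_lowerBound` + the numerics of `stub_denseRegime`): a `VNP ⊄ VBP`-strength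
  consequence in every characteristic, i.e. the GRANK single-gate statement is at least Valiant-hard (this is the crux
  Disproof's headline `dc_cliquePoly_superpolynomial_of_linAlgGateBlind` localised to one stub).

Both theorems are CONDITIONAL by design (their hypotheses are the two open single-gate statements, written inline, not
asserted anywhere); they credit nothing toward the item and exist so that any future proof of the single-gate statements
closes the crux by `exact linAlgGateBlind_of_sgAt hP hG`. Sources: Razborov 1985, Alon–Boppana 1987 §3 (method);
this line's card `Cruxes/LinAlgGateBlind/Ideas/dnf-invariant-wide-gates-see-small-cliques.md`. [folklore]
-/

-- `Summit.PneNP.PneNP.…` duplicates `PneNP` BY DESIGN (single-problem summit).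
set_option linter.dupNamespace false

namespace Summit.PneNP.PneNP.Cruxes.LinAlgGateBlind.DnfInvariantWideGatesSeeSmallCliques

open scoped BigOperators
open Finset Filter Literature.Computability.Complexity Razborov

noncomputable section

/-! ### The crux read back -/

/-- **Read-back**: the crux IS `∃ δ ∈ (0,1/2), ∀ c, ∀ᶠ m, ∀ C over {∧₂,∨₂} ∪ PERM_{m^c} ∪ GRANK_{m^c}, size ≤ m^c →
¬ Computes CLIQUE(m,⌈m^δ⌉)`, by `Iff.rfl` (the inline clique function is `cliqueFn`, the inline gate classes are
`IsPermGate`/`IsGRankGate`). [folklore] -/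
theorem linAlgGateBlind_iff_reduction :
    Summit.PneNP.PneNP.Theses.ConvexRankGates.LinAlgGateBlind ↔
      ∃ δ : ℝ, 0 < δ ∧ δ < 1 / 2 ∧ ∀ c : ℕ, ∀ᶠ m : ℕ in atTop, ∀ C : Circuit (KEdge m),
        C.IsOver ({GateFn.and 2, GateFn.or 2} ∪ {g | IsPermGate (m ^ c) g ∨ IsGRankGate (m ^ c) g}) →
          C.size ≤ m ^ c → ¬ C.Computes (cliqueFn m ⌈(m : ℝ) ^ δ⌉₊) := Iff.rfl

/-- Every PERM / GRANK gate computes a monotone Boolean function (`IsPermGate.monotone`, `IsGRankGate.monotone`).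
[folklore] -/
theorem monotone_of_isPermGate_or_isGRankGate {s : ℕ} {g : GateFn} (hg : IsPermGate s g ∨ IsGRankGate s g) :
    Monotone g.2 := by
  rcases hg with hg | hg
  · exact hg.monotone
  · exact hg.monotone

/-- Enlarging the approximating family can only shrink the set of lost positives. [folklore] -/
theorem lostPos_anti' {m k : ℕ} (O : (KEdge m → Bool) → Bool) {𝒜 ℬ : Finset (Finset (Fin m))}
    (h : 𝒜 ⊆ ℬ) : lostPos m k O ℬ ⊆ lostPos m k O 𝒜 := by
  intro S hS
  simp only [lostPos, mem_filter] at hS ⊢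
  exact ⟨hS.1, hS.2.1, fun hacc => hS.2.2 (hacc.mono h)⟩

/-- Replacing `𝒜` by a family `ℬ` gains at most the `G(m,q)`-mass of `[⌈ℬ⌉ ∧ ¬⌈𝒜⌉]` (union bound). [folklore] -/
theorem gainedNeg_le_add' {m : ℕ} {q : ℝ} (hq0 : 0 ≤ q) (hq1 : q ≤ 1) (O : (KEdge m → Bool) → Bool)
    (𝒜 ℬ : Finset (Finset (Fin m))) :
    gainedNeg m q O ℬ ≤ gainedNeg m q O 𝒜 +
      prob q (fun x : KEdge m → Bool => Accepts ℬ x ∧ ¬ Accepts 𝒜 x) := by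
  unfold gainedNeg
  calc prob q (fun x : KEdge m → Bool => O x = false ∧ Accepts ℬ x)
      ≤ prob q (fun x : KEdge m → Bool =>
          (O x = false ∧ Accepts 𝒜 x) ∨ (Accepts ℬ x ∧ ¬ Accepts 𝒜 x)) :=
        prob_mono hq0 hq1 fun x hx => by
          by_cases h𝒜 : Accepts 𝒜 x
          · exact Or.inl ⟨hx.1, h𝒜⟩
          · exact Or.inr ⟨hx.2, h𝒜⟩
    _ ≤ _ := prob_or_le hq0 hq1 _ _

/-! ### The reduction theorem -/

/-- **Reduction of the crux to two single-gate statements** (registered sub-goal `linAlgGateBlind_of_sgAt` of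
stmt-PneNP-10681). Take `δ = 1/8`; for each `c` intersect the `∀ᶠ m` filters of the dense regime (`stub_denseRegime`)
and of the two SG hypotheses; at such an `m` feed the host `stub_wideApproxHost` with `W := Lin (m^c)`, `t := m^c`,
`εP := ε`, `εN := 2ε`: the `∨`-hypothesis is plucking (`stub_pluckingBound`) within budget, the `∧`-hypothesis is
the tree's `card_errPos_le_wide` within budget, and a `Lin` gate over closed children collapses (`stub_termCollapse`)
to a term gate of its own class, gets an SG-approximator `𝒜`, and `closure 𝒜` is the closed approximator (lost
cliques only decrease, gained mass grows by the plucking error); the endgame budgets are `m^c ε ≤ 1/16` and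
`2/16 + 1/4 < 1/2 ≤ q^{C(l,2)}`. CONDITIONAL on its two hypotheses (the open stubs `stub_sgPerm`, `stub_sgGRank` of the
line), credits nothing by itself. [folklore] -/
theorem linAlgGateBlind_of_sgAt : (∀ c : ℕ, ∀ᶠ m : ℕ in atTop, SGAt m (IsPermGate (m ^ c)) (lOf m) (kOf m) (qOf m) (epsOf c m)) → (∀ c : ℕ, ∀ᶠ m : ℕ in atTop, SGAt m (IsGRankGate (m ^ c)) (lOf m) (kOf m) (qOf m) (epsOf c m)) → Summit.PneNP.PneNP.Theses.ConvexRankGates.LinAlgGateBlind := by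
  intro hPerm hGRank
  rw [linAlgGateBlind_iff_reduction]
  refine ⟨1 / 8, by norm_num, by norm_num, fun c => ?_⟩
  filter_upwards [stub_denseRegime c, hPerm c, hGRank c] with m hR hP hG C hC hsize
  obtain ⟨hl, hr, hkm, hq0, hq1, hpl, hand, heps, hclq, hhalf⟩ := hR
  have hε : 0 ≤ epsOf c m := epsOf_nonneg c m
  refine stub_wideApproxHost m (kOf m) (rOf c m) (lOf m) (m ^ c) (qOf m) (epsOf c m) (2 * epsOf c m) {g | IsPermGate (m ^ c) g ∨ IsGRankGate (m ^ c) g}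
    hr hl hkm hq0 hq1 hε (mul_nonneg (by norm_num) hε) (fun g hg => monotone_of_isPermGate_or_isGRankGate hg)
    ?_ ?_ ?_ ?_ ?_ C hC hsize
  · -- (∨): plucking within budget
    intro A B hA hB
    calc prob (qOf m) (fun x : KEdge m → Bool =>
          Accepts (closure (rOf c m) (lOf m) (A ∪ B)) x ∧ ¬ Accepts (A ∪ B) x)
        ≤ (#(smallSets (Fin m) (lOf m)) : ℝ) * (1 - qOf m ^ ((lOf m).choose 2)) ^ rOf c m :=
          stub_pluckingBound m (rOf c m) (lOf m) (qOf m) hq0 hq1 (A ∪ B) (union_subset hA.subset hB.subset)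
      _ ≤ epsOf c m := hpl
      _ ≤ 2 * epsOf c m := by linarith
  · -- (∧): Alon–Boppana trimming count (tree) within budget
    intro A B hA hB
    calc (#(errPos (kOf m) A B) : ℝ)
        ≤ ((((rOf c m - 1) ^ lOf m) ^ 2 * (m - (lOf m + 1)).choose (kOf m - (lOf m + 1)) : ℕ) : ℝ) := by
          exact_mod_cast card_errPos_le_wide hr hA hB
      _ ≤ epsOf c m * (m.choose (kOf m) : ℝ) := hand
  · -- wide gates: collapse to a term gate, SG, re-close
    intro g hg A hA
    have hsub : ∀ i, A i ⊆ smallSets (Fin m) (lOf m) := fun i => (hA i).subset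
    obtain ⟨𝒜, h𝒜, hlost, hgain⟩ : ∃ 𝒜 ⊆ smallSets (Fin m) (lOf m),
        (#(lostPos m (kOf m) (fun x => g.2 fun i => acceptsB (A i) x) 𝒜) : ℝ)
            ≤ epsOf c m * (m.choose (kOf m) : ℝ) ∧
          gainedNeg m (qOf m) (fun x => g.2 fun i => acceptsB (A i) x) 𝒜 ≤ epsOf c m := by
      rcases hg with hg | hg
      · exact hP _ ((stub_termCollapse m (m ^ c) (lOf m) g A hsub).1 hg)
      · exact hG _ ((stub_termCollapse m (m ^ c) (lOf m) g A hsub).2 hg)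
    refine ⟨closure (rOf c m) (lOf m) 𝒜, isClosedFamily_closure _ _ _, ?_, ?_⟩
    · calc (#(lostPos m (kOf m) (fun x => g.2 fun i => acceptsB (A i) x)
            (closure (rOf c m) (lOf m) 𝒜)) : ℝ)
          ≤ (#(lostPos m (kOf m) (fun x => g.2 fun i => acceptsB (A i) x) 𝒜) : ℝ) := by
            exact_mod_cast card_le_card (lostPos_anti' _ (subset_closure h𝒜))
        _ ≤ epsOf c m * (m.choose (kOf m) : ℝ) := hlost
    · calc gainedNeg m (qOf m) (fun x => g.2 fun i => acceptsB (A i) x) (closure (rOf c m) (lOf m) 𝒜)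
          ≤ gainedNeg m (qOf m) (fun x => g.2 fun i => acceptsB (A i) x) 𝒜 +
              prob (qOf m) (fun x : KEdge m → Bool =>
                Accepts (closure (rOf c m) (lOf m) 𝒜) x ∧ ¬ Accepts 𝒜 x) :=
            gainedNeg_le_add' hq0 hq1 _ _ _
        _ ≤ epsOf c m + (#(smallSets (Fin m) (lOf m)) : ℝ) * (1 - qOf m ^ ((lOf m).choose 2)) ^ rOf c m :=
            add_le_add hgain (stub_pluckingBound m (rOf c m) (lOf m) (qOf m) hq0 hq1 𝒜 h𝒜)
        _ ≤ 2 * epsOf c m := by linarith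
  · -- positive-side budget: `m^c ε ≤ 1/16 < 1`
    exact lt_of_le_of_lt heps (by norm_num)
  · -- negative-side budget: `2 m^c ε + Pr[clique] ≤ 1/8 + 1/4 < 1/2 ≤ q^{C(l,2)}`
    have h2 : ((m ^ c : ℕ) : ℝ) * (2 * epsOf c m) = 2 * (((m ^ c : ℕ) : ℝ) * epsOf c m) := by ring
    rw [h2]
    linarith


/-! ### Calibration of the GRANK hypothesis -/

/-- **`SG_GRANK ⇒ dc_F(CL_{m,⌈m^{1/8}⌉}) > m^c` eventually in `m`, for every `c` and EVERY field `F`.** The numerics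
of `stub_denseRegime` (`2 ≤ l`, `k ≤ m`, `q ∈ [0,1]`, `m^c ε ≤ 1/16`, `Pr[clique] ≤ 1/4`, `q^{C(l,2)} ≥ 1/2`) and
`denseRegime_params` (`m^{1/16} ≥ c + 3`) discharge the explicit hypotheses of the landed certificate
`sgAt_gRank_dc_lowerBound`: if `CL_{m,k}` were the determinant of an affine matrix of size `≤ m^c`, `CLIQUE(m,k)`
itself would be ONE GRANK term gate (over 2-atoms) for which no small-clique DNF is a one-sided approximator.
CONDITIONAL (hypothesis = the open stub `stub_sgGRank`); this is the kernel-checked reason that stub is crux-sized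
(at least `VNP ⊄ VBP` over every field). [folklore] -/
theorem sgGRank_forces_dc_lowerBound
    (hG : ∀ c : ℕ, ∀ᶠ m : ℕ in atTop, SGAt m (IsGRankGate (m ^ c)) (lOf m) (kOf m) (qOf m) (epsOf c m))
    (c : ℕ) (F : Type) [Field F] :
    ∀ᶠ m : ℕ in atTop, ∀ d ≤ m ^ c,
      ¬ Literature.Computability.AlgebraicComplexity.HasDetRepr
        (Summit.PneNP.PneNP.Theorems.LinAlgGateBlind.Negative.cliquePoly m F (kOf m)) d := by
  filter_upwards [hG c, stub_denseRegime c, denseRegime_params c] with m hSG hR hP d hd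
  obtain ⟨hl, -, hkm, hq0, hq1, -, -, heps, hclq, hhalf⟩ := hR
  obtain ⟨h4, -, hc3, -⟩ := hP
  have hx2 : (2 : ℝ) ≤ (m : ℝ) ^ (1 / 16 : ℝ) := by
    have hc0 : (0 : ℝ) ≤ (c : ℝ) := Nat.cast_nonneg c
    linarith
  have hk2 : 2 ≤ kOf m := by
    have := DenseRegime.lOf_add_one_le_kOf hx2
    omega
  have hε : epsOf c m ≤ 1 / 16 := by
    have h1 : (1 : ℝ) ≤ ((m ^ c : ℕ) : ℝ) := by
      have : 1 ≤ m ^ c := Nat.one_le_pow _ _ (by omega)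
      exact_mod_cast this
    exact (le_mul_of_one_le_left (epsOf_nonneg c m) h1).trans heps
  have hε1 : epsOf c m < 1 := by linarith
  have hbudget : prob (qOf m) (fun x : KEdge m → Bool => cliqueFn m (kOf m) x = true) + epsOf c m <
      qOf m ^ ((lOf m).choose 2) := by linarith
  exact sgAt_gRank_dc_lowerBound m (lOf m) (kOf m) (m ^ c) d (qOf m) (epsOf c m) F hl hk2 hkm hq0 hq1 hε1
    hbudget hd hSG

end

end Summit.PneNP.PneNP.Cruxes.LinAlgGateBlind.DnfInvariantWideGatesSeeSmallCliques
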